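import Summits.RiemannHypothesis.RiemannHypothesis.Theorems.EvenSectorBartaEvenOneSignedWindowsEdgeChannel
import HarnessLib

/-!
# The τ-free edge–Wronskian law (IDEAS-finite-rank.md PART G13, handoff-idea-3 gen13)
(rh-explicit; authored by the H-P ideation seat `handoff-idea-3` gen13 as deposit g13/EdgeWronskianTauFree.lean 6bf4987d…; landed by handoff-prove-1 gen7 as `Theorems/EvenSectorBartaEvenOneSignedWindowsTauFree.lean` (P-G13-1, --supports stmt-RiemannHypothesis-19953 --as helper) with exactly these changes: namespace `…Theorems.EvenSectorBartaEvenOneSignedWindowsTauFree` in place of `…Sketch.HandoffG13`, and this provenance clause.)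

**H-P ideation, rh-explicit; long-odds MECHANISM SEARCH; no RH claims.**  Nothing in this file is,
or suggests, a proof of RH; every `def … : Prop` below is a HYPOTHESIS SHAPE used explicitly.

PART G12 typed the EDGE–WRONSKIAN LAW `(μ − ε)·P = c·τu·τv` (parity gap × bulk pairing =
constant × even edge trace × odd edge trace) and combined it with the tree's Hadamard-type edge law
`HadamardEdgeLaw ε τu κ a₀` (`ε' = −κ τu²`).  PART G13 observes that when the translation flux
constant `c` and the dilation (Hadamard) constants `κ, κ'` come from ONE rank-one edge flux form —
`c² = κ κ'`, as is a THEOREM for the fractional Dirichlet Laplacian (Djitte–Fall–Weth, Adv. Calc.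
Var. 2023, Thm 1.3 with Thm 3.1, arXiv:2112.10653: the same `Γ(1+s)²` for every deformation
field) — the traces CANCEL:

  `TauFreeLaw ε μ P a₀ :  ((μ a − ε a) · P a)² = ε'(a) · μ'(a)`   for all `a ≥ a₀`,

a law among three window observables (parity gap, bulk pairing `P = ⟨ψ_odd, −u'_even⟩`, and the
two Danskin slopes) with NO trace, NO constant and NO free parameter.  Consequences proved here
(trivial real analysis): parity crossings are exactly common zeros of the slope product
(`slopes_mul_eq_zero_of_parityCrossing`); hence, while the pairing does not vanish,
"NO PARITY CROSSING on `[a₀, ∞)`" ⟺ "NEITHER parity bottom has a CRITICAL WINDOW on `[a₀, ∞)`"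
(`noParityCrossing_iff_noCriticalWindows`), and with continuity the initial parity order persists
(`parityOrder_of_noCriticalWindows`).  The output `NoCriticalWindow ε a₀` is precisely the input of
the tree's `edgeTrace_pos_of_noCriticalWindow` (edge channel of `EvenOneSignedWindows`).
The law is sign-blind: it does not by itself order the parities (PART G13 says so).
-/

set_option linter.dupNamespace false

noncomputable section

open Set Filter
open scoped Topology

namespace Summit.RiemannHypothesis.RiemannHypothesis.Theorems.EvenSectorBartaEvenOneSignedWindowsTauFree

open Summit.RiemannHypothesis.RiemannHypothesis.Theorems.PolarPerronFrobenius
  (HadamardEdgeLaw NoCriticalWindow deriv_eq_zero_iff_edgeTrace_eq_zero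
   edgeTrace_pos_of_noCriticalWindow)

/-- τ-FREE EDGE–WRONSKIAN LAW on `[a₀, ∞)` (IDEAS-finite-rank.md PART G13, conjecture EW♯ in
squared form): `((μ − ε)·P)² = ε'·μ'` at every window `a ≥ a₀`.  A DEFINITION used only as an
explicit hypothesis — posited, not a fact. [folklore] -/
def TauFreeLaw (ε μ P : ℝ → ℝ) (a₀ : ℝ) : Prop :=
  ∀ a, a₀ ≤ a → ((μ a - ε a) * P a) ^ 2 = deriv ε a * deriv μ a

variable {ε μ τu τv P : ℝ → ℝ} {c κ κ' a₀ a : ℝ}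

/-- Algebra behind the cancellation: an edge–Wronskian law with constant `c` and Hadamard-type
laws with constants `κ, κ'` give `κ κ' · ((μ−ε)P)² = c² · ε' μ'`. -/
theorem sq_gap_mul_pairing (hε : HadamardEdgeLaw ε τu κ a₀) (hμ : HadamardEdgeLaw μ τv κ' a₀)
    (hW : ∀ a, a₀ ≤ a → (μ a - ε a) * P a = c * τu a * τv a) (ha : a₀ ≤ a) :
    κ * κ' * ((μ a - ε a) * P a) ^ 2 = c ^ 2 * (deriv ε a * deriv μ a) := by
  rw [hW a ha, (hε.2 a ha).deriv, (hμ.2 a ha).deriv]; ring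

/-- **One flux form ⇒ the traces cancel.** If `c² = κ κ'` (in particular `c = κ = κ'`: the
translation and dilation variations are governed by the same rank-one edge form), the
edge–Wronskian law and the two Hadamard-type laws give the τ-free law. -/
theorem tauFreeLaw_of_edgeWronskian (hε : HadamardEdgeLaw ε τu κ a₀)
    (hμ : HadamardEdgeLaw μ τv κ' a₀)
    (hW : ∀ a, a₀ ≤ a → (μ a - ε a) * P a = c * τu a * τv a) (hc : c ^ 2 = κ * κ') :
    TauFreeLaw ε μ P a₀ := by
  intro a ha
  have h := sq_gap_mul_pairing hε hμ hW ha
  rw [← hc] at h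
  have hc0 : c ^ 2 ≠ 0 := by rw [hc]; exact (mul_pos hε.1 hμ.1).ne'
  exact mul_left_cancel₀ hc0 h

/-- At a parity crossing the product of the two Danskin slopes vanishes. -/
theorem slopes_mul_eq_zero_of_parityCrossing (hT : TauFreeLaw ε μ P a₀) (ha : a₀ ≤ a)
    (hcross : ε a = μ a) : deriv ε a * deriv μ a = 0 := by
  rw [← hT a ha, hcross, sub_self, zero_mul]; ring

/-- … so one of the two parity bottoms is critical (stationary) there. -/
theorem slope_eq_zero_or_of_parityCrossing (hT : TauFreeLaw ε μ P a₀) (ha : a₀ ≤ a)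
    (hcross : ε a = μ a) : deriv ε a = 0 ∨ deriv μ a = 0 :=
  mul_eq_zero.1 (slopes_mul_eq_zero_of_parityCrossing hT ha hcross)

/-- **Parity crossings are critical windows (⇒).** If neither parity bottom has a critical window
on `[a₀, ∞)`, the two levels never meet there. -/
theorem ne_of_noCriticalWindows (hT : TauFreeLaw ε μ P a₀) (hεc : NoCriticalWindow ε a₀)
    (hμc : NoCriticalWindow μ a₀) (ha : a₀ ≤ a) : ε a ≠ μ a := by
  intro h
  rcases slope_eq_zero_or_of_parityCrossing hT ha h with h1 | h1
  · exact hεc a ha h1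
  · exact hμc a ha h1

/-- **(⇐).** If the levels never meet and the bulk pairing never vanishes on `[a₀, ∞)`, then
NEITHER parity bottom has a critical window there. -/
theorem noCriticalWindows_of_ne (hT : TauFreeLaw ε μ P a₀) (hP : ∀ a, a₀ ≤ a → P a ≠ 0)
    (hne : ∀ a, a₀ ≤ a → ε a ≠ μ a) : NoCriticalWindow ε a₀ ∧ NoCriticalWindow μ a₀ := by
  have key : ∀ a, a₀ ≤ a → deriv ε a * deriv μ a ≠ 0 := fun a ha ↦ by
    rw [← hT a ha]
    exact pow_ne_zero 2 (mul_ne_zero (sub_ne_zero.2 (hne a ha).symm) (hP a ha))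
  exact ⟨fun a ha h0 ↦ key a ha (by rw [h0, zero_mul]),
    fun a ha h0 ↦ key a ha (by rw [h0, mul_zero])⟩

/-- **PARITY CROSSINGS = CRITICAL WINDOWS.** Under the τ-free law with non-vanishing bulk pairing,
"the parity levels never meet on `[a₀, ∞)`" is EQUIVALENT to "neither parity bottom has a critical
window on `[a₀, ∞)`" — a statement about ENERGIES and one pairing, with no trace and no constant. -/
theorem noParityCrossing_iff_noCriticalWindows (hT : TauFreeLaw ε μ P a₀)
    (hP : ∀ a, a₀ ≤ a → P a ≠ 0) :
    (∀ a, a₀ ≤ a → ε a ≠ μ a) ↔ NoCriticalWindow ε a₀ ∧ NoCriticalWindow μ a₀ :=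
  ⟨noCriticalWindows_of_ne hT hP, fun h _ ha ↦ ne_of_noCriticalWindows hT h.1 h.2 ha⟩

/-- **Parity ORDER persists.** τ-free law, no critical windows for either parity, a continuous
gap and the initial order `ε a₀ < μ a₀` give `ε < μ` on all of `[a₀, ∞)` (intermediate values). -/
theorem parityOrder_of_noCriticalWindows (hT : TauFreeLaw ε μ P a₀)
    (hεc : NoCriticalWindow ε a₀) (hμc : NoCriticalWindow μ a₀)
    (hcont : ContinuousOn (fun a ↦ μ a - ε a) (Ici a₀)) (h0 : ε a₀ < μ a₀) :
    ∀ a, a₀ ≤ a → ε a < μ a := by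
  intro a ha
  by_contra hlt
  have hle : μ a ≤ ε a := not_lt.1 hlt
  have hc' : ContinuousOn (fun a ↦ μ a - ε a) (Icc a₀ a) := hcont.mono fun x hx ↦ hx.1
  have hmem : (0 : ℝ) ∈ Icc (μ a - ε a) (μ a₀ - ε a₀) := ⟨sub_nonpos.2 hle, (sub_pos.2 h0).le⟩
  obtain ⟨ξ, hξ, hξ0⟩ := intermediate_value_Icc' ha hc' hmem
  exact ne_of_noCriticalWindows hT hεc hμc hξ.1 (sub_eq_zero.1 hξ0).symm

/-- **Hook to the served crux's edge channel.** Under the τ-free law with non-vanishing pairing,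
non-crossing parity levels make the EVEN bottom free of critical windows; with the tree's
Hadamard-type law, a continuous even trace positive at `a₀` then stays positive on `[a₀, ∞)`
(`edgeTrace_pos_of_noCriticalWindow`, Theorems/…EdgeChannel) — no zero is born at the edge. -/
theorem edgeTrace_pos_of_noParityCrossing (hT : TauFreeLaw ε μ P a₀)
    (hP : ∀ a, a₀ ≤ a → P a ≠ 0) (hne : ∀ a, a₀ ≤ a → ε a ≠ μ a)
    (hlaw : HadamardEdgeLaw ε τu κ a₀) (hτ : ContinuousOn τu (Ici a₀)) (hτ0 : 0 < τu a₀) :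
    ∀ a, a₀ ≤ a → 0 < τu a :=
  edgeTrace_pos_of_noCriticalWindow hlaw (noCriticalWindows_of_ne hT hP hne).1 hτ hτ0

end Summit.RiemannHypothesis.RiemannHypothesis.Theorems.EvenSectorBartaEvenOneSignedWindowsTauFree

end
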